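import Summits.BirchSwinnertonDyer.BirchSwinnertonDyer.Theorems.ClassRecordThreeEulerHalvesAtThreeCartanTorusCubeCutPSLineNine
import Summits.BirchSwinnertonDyer.BirchSwinnertonDyer.Theorems.ClassRecordThreeEulerHalvesAtThreeCartanTorusCubeCutPSUnipotentRank
import Summits.BirchSwinnertonDyer.BirchSwinnertonDyer.Theorems.ClassRecordThreeEulerHalvesAtThreeCartanTorusCubeCut
import Summits.BirchSwinnertonDyer.BirchSwinnertonDyer.Theorems.ClassRecordThreeEulerHalvesAtThreeCartanTorusCubeCutCuspNorm
import Summits.BirchSwinnertonDyer.BirchSwinnertonDyer.Theorems.ClassRecordThreeEulerHalvesAtThreeCartanTorusCubeCutCuspGoodConjugate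
import HarnessLib

/-!
# Crux 23422 line `cartan` v9, stub (F2a) — file PS-8: the PRINCIPAL-SERIES CLOSERS. The three inputs (P1) `P_psNonsplitNormLower`,
# (P2) `P_psSplitNormSharp`, (P3) `P_psNonsplitNormSharp`, and (F2a) `CartanDegree.CubicTorusPeriodRatioAtThreeGeFive` itself, from ONE
# 𝔽₃-linear-algebra statement per lattice: the STEINBERG HYPERPLANE `HasSteinbergHyperplane 𝓛`

Seat `bsd-stepL-cartan-f2a` g0 (explicit unit, pen g44 AUTOFILL #2 row (3′); `--supports stmt-BirchSwinnertonDyer-23422 --as helper`).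
`HasSteinbergHyperplane 𝓛` (a `Prop`, the only definition here) packages what the Steinberg module `St ⊗ 𝔽₃ ≅ I₀ ⊂ 𝔽₃[P¹(𝔽_q)]` supplies
about `X̄ = X/3X = 𝔽₃^d` (assembly by the line owner tam3-p1 g21 from `…SteinbergSimple`): a `ρ̄`-stable subspace `W ⊂ X̄` (the image
of `I₀` under `e_P ↦ ρ̄(g_P)v̄`, `v̄` Borel-fixed) with trivial quotient action, simple as `𝔽₃[G]`-module, of codimension one
(`finrank W + 1 = d`), containing the reduction of a lattice vector whose mirabolic norm `N_D x` is not in `3X`, and whose `U`-fixed vectors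
lie on a line. CONSEQUENCES (all sorry-free, assembling files PS-1 … PS-7 and the line owner's cusp theorems):
* `psNonsplitNormLower_of_steinberg`, `psSplitNormSharp_of_steinberg`, `psNonsplitNormSharp_of_steinberg` :
  `(∀ q ≥ 5, q ≡ 1 (3), ∀ 𝓛, HasSteinbergHyperplane 𝓛) → P_ps*` — the three registered-shape inputs of bsd-idea-10's cut;
* **`cubicTorusPeriodRatioAtThreeGeFive_of_steinberg`** : the same hypothesis `→ CartanDegree.CubicTorusPeriodRatioAtThreeGeFive`, i.e.
  stub (F2a) BY NAME, via `cubicTorusPeriodRatioAtThreeGeFive_of` with the cusp inputs `cuspCubeNormFixed` (p684168) and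
  `cuspGoodConjugate` (p684583) of tam3-p1 g21 (theorems) and the three PS inputs above.
HONEST FRAMING: CONDITIONAL closers — the Steinberg hyperplane is NOT constructed here (it is the line owner's claimed assembly); S-K1′ is
proved here ONLY modulo `HasSteinbergHyperplane`; no summit statement, no route item and no registered stub is proved unconditionally; BSD is
proved for no curve. [folklore]
-/

namespace Summit.BirchSwinnertonDyer.BirchSwinnertonDyer.Theorems.CartanTorusCubeCut.PS

open Summit.BirchSwinnertonDyer.BirchSwinnertonDyer.Theorems.CartanDegree
open Summit.BirchSwinnertonDyer.BirchSwinnertonDyer.Theorems.CartanTorusCubeCut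

set_option linter.dupNamespace false
set_option autoImplicit false

section Closers
variable {q : ℕ} [Fact q.Prime]

/-- **the Steinberg hyperplane of a Cartan torus lattice** (`q ≡ 1 (mod 3)`): a `ρ̄`-stable `𝔽₃`-subspace `W ⊂ X̄ = 𝔽₃^d` with trivial
quotient action, simple as `𝔽₃[GL₂(𝔽_q)]`-module, of codimension `1`, containing the reduction of some `x` with `N_D x ∉ 3X`, and whose
vectors fixed by all upper unipotents lie on one line. (In the dictionary: `W = image of St ⊗ 𝔽₃`, `X̄/W ≅ 𝟙`.) -/
def HasSteinbergHyperplane (𝓛 : CartanTorusLattice q) : Prop :=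
  ∃ W : Submodule (ZMod 3) (Fin 𝓛.d → ZMod 3),
    (∀ g : G q, ∀ w ∈ W, redEnd 𝓛.d (𝓛.ρ g) w ∈ W) ∧
    (∀ (g : G q) (y : Fin 𝓛.d → ZMod 3), redEnd 𝓛.d (𝓛.ρ g) y - y ∈ W) ∧
    (∀ W' : Submodule (ZMod 3) (Fin 𝓛.d → ZMod 3),
      (∀ g : G q, ∀ w ∈ W', redEnd 𝓛.d (𝓛.ρ g) w ∈ W') → W' ≤ W → (W' = ⊥ ∨ W' = W)) ∧
    Module.finrank (ZMod 3) W + 1 = 𝓛.d ∧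
    (∃ x : Fin 𝓛.d → ℤ, red 𝓛.d x ∈ W ∧ ¬ ∃ y, (∑ a : (ZMod q)ˣ, 𝓛.ρ (diagGL ![a, 1]) x) = (3 : ℤ) • y) ∧
    (∃ x₀ : Fin 𝓛.d → ZMod 3, ∀ w ∈ W,
      (∀ g : G q, (g : Mat q) 1 0 = 0 → (g : Mat q) 0 0 = 1 → (g : Mat q) 1 1 = 1 → redEnd 𝓛.d (𝓛.ρ g) w = w) →
        w ∈ (ZMod 3) ∙ x₀)

omit [Fact q.Prime] in
/-- a codimension-one subspace is proper. -/
theorem ne_top_of_finrank_add_one {𝓛 : CartanTorusLattice q} {W : Submodule (ZMod 3) (Fin 𝓛.d → ZMod 3)}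
    (hdim : Module.finrank (ZMod 3) W + 1 = 𝓛.d) : W ≠ ⊤ := by
  intro h
  rw [h, finrank_top, Module.finrank_fin_fun] at hdim
  omega

/-- from «`W^U` lies on a line» to a `U`-FIXED LATTICE VECTOR OUTSIDE `red⁻¹(W)` (file PS-7: `N_U X` is not cyclic mod 3). -/
theorem exists_unipotentFixed_red_not_mem (𝓛 : CartanTorusLattice q) (h1 : q % 3 = 1)
    (W : Submodule (ZMod 3) (Fin 𝓛.d → ZMod 3))
    (hWU : ∃ x₀ : Fin 𝓛.d → ZMod 3, ∀ w ∈ W,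
      (∀ g : G q, (g : Mat q) 1 0 = 0 → (g : Mat q) 0 0 = 1 → (g : Mat q) 1 1 = 1 → redEnd 𝓛.d (𝓛.ρ g) w = w) →
        w ∈ (ZMod 3) ∙ x₀) :
    ∃ u₀ : Fin 𝓛.d → ℤ,
      (∀ g : G q, (g : Mat q) 1 0 = 0 → (g : Mat q) 0 0 = 1 → (g : Mat q) 1 1 = 1 → 𝓛.ρ g u₀ = u₀) ∧ red 𝓛.d u₀ ∉ W := by
  classical
  obtain ⟨x₀, hx₀⟩ := hWU
  obtain ⟨u, hu⟩ := exists_unipotentParam (q := q)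
  obtain ⟨x₀', rfl⟩ := red_surjective 𝓛.d x₀
  obtain ⟨y, hy⟩ := exists_normU_not_mem_line u hu 𝓛 h1 x₀'
  -- `u₀ = N_U y`
  refine ⟨(∑ t : ZMod q, 𝓛.ρ (u t)) y, ?_, ?_⟩
  · -- an upper unipotent `g` equals `u (g₀₁)`, and `ρ(u s) N_U = N_U`
    intro g h10 h00 h11
    have hg : g = u ((g : Mat q) 0 1) := by
      apply Units.ext
      rw [hu]
      ext i j; fin_cases i <;> fin_cases j <;> simp [h10, h00, h11]
    rw [hg, ← Module.End.mul_apply, Finset.mul_sum]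
    simp_rw [← map_mul, unipotentParam_mul u hu]
    congr 1
    exact Fintype.sum_equiv (Equiv.addLeft ((g : Mat q) 0 1)) _ _ (fun _ => rfl)
  · intro hmem
    have hfix : ∀ g : G q, (g : Mat q) 1 0 = 0 → (g : Mat q) 0 0 = 1 → (g : Mat q) 1 1 = 1 →
        redEnd 𝓛.d (𝓛.ρ g) (red 𝓛.d ((∑ t : ZMod q, 𝓛.ρ (u t)) y)) = red 𝓛.d ((∑ t : ZMod q, 𝓛.ρ (u t)) y) := by
      intro g h10 h00 h11
      have hg : g = u ((g : Mat q) 0 1) := by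
        apply Units.ext
        rw [hu]
        ext i j; fin_cases i <;> fin_cases j <;> simp [h10, h00, h11]
      rw [redEnd_red, hg, ← Module.End.mul_apply, Finset.mul_sum]
      simp_rw [← map_mul, unipotentParam_mul u hu]
      congr 2
      exact Fintype.sum_equiv (Equiv.addLeft ((g : Mat q) 0 1)) _ _ (fun _ => rfl)
    have hspan := hx₀ _ hmem hfix
    rw [Submodule.mem_span_singleton] at hspan
    obtain ⟨c, hc⟩ := hspan
    -- `red (N_U y) = c • red x₀'` ⇒ `N_U y = c' x₀' + 3 z`
    have hc' : red 𝓛.d ((∑ t : ZMod q, 𝓛.ρ (u t)) y) = red 𝓛.d ((c.val : ℤ) • x₀') := by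
      rw [← hc, map_zsmul, natCast_zsmul, ← Nat.cast_smul_eq_nsmul (ZMod 3), ZMod.natCast_zmod_val]
    obtain ⟨z, hz⟩ := (red_sub_eq_zero_iff 𝓛.d _ _).1 hc'
    exact hy (c.val : ℤ) z (by rw [← hz]; abel)

/-- the mod-3 line hypotheses of `ps*_of_line`, unpacked from a Steinberg hyperplane. -/
theorem line_of_steinberg (𝓛 : CartanTorusLattice q) (h1 : q % 3 = 1) (hSt : HasSteinbergHyperplane 𝓛) :
    ∃ XM : Submodule ℤ (Fin 𝓛.d → ℤ),
      ((∀ g : G q, ∀ x ∈ XM, 𝓛.ρ g x ∈ XM) ∧ (∀ x, (3 : ℤ) • x ∈ XM) ∧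
        (∀ (g : G q) (x : Fin 𝓛.d → ℤ), 𝓛.ρ g x - x ∈ XM) ∧ XM ≠ ⊤) ∧
      (∀ L : Submodule ℤ (Fin 𝓛.d → ℤ), (∀ g : G q, ∀ x ∈ L, 𝓛.ρ g x ∈ L) →
        (∀ x, (3 : ℤ) • x ∈ L) → L ≤ XM → (L = XM ∨ ∀ x ∈ L, ∃ y, x = (3 : ℤ) • y)) ∧
      (∀ x, x ∉ XM → ∀ y, ∃ a : ℤ, y - a • x ∈ XM) ∧
      (∃ x ∈ XM, ¬ ∃ y, (∑ a : (ZMod q)ˣ, 𝓛.ρ (diagGL ![a, 1]) x) = (3 : ℤ) • y) ∧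
      (∃ (d₀ : G q) (u₀ : Fin 𝓛.d → ℤ), u₀ ∉ XM ∧ u₀ + 𝓛.ρ d₀ u₀ + 𝓛.ρ d₀ (𝓛.ρ d₀ u₀) = 0) := by
  obtain ⟨W, hW, htriv, hsimple, hdim, ⟨x, hxW, hx⟩, hWU⟩ := hSt
  obtain ⟨u₀, hu₀, hu₀W⟩ := exists_unipotentFixed_red_not_mem 𝓛 h1 W hWU
  obtain ⟨a, ha⟩ := exists_nonCube (q := q) h1
  obtain ⟨u, hu⟩ := exists_unipotentParam (q := q)
  refine ⟨(W.restrictScalars ℤ).comap (red 𝓛.d), hline_of_subspace 𝓛 W hW htriv (ne_top_of_finrank_add_one hdim),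
    hsimple_of_subspace 𝓛 W hsimple, hcyc_of_subspace 𝓛 W hdim, ⟨x, (mem_comap_red_iff 𝓛 W x).2 hxW, hx⟩,
    ⟨diagGL ![a, 1], u₀, fun h => hu₀W ((mem_comap_red_iff 𝓛 W u₀).1 h),
      cube_relation_of_unipotentFixed u hu 𝓛 h1 ha u₀ hu₀⟩⟩

/-- **(P1) from the Steinberg hyperplanes.** -/
theorem psNonsplitNormLower_of_steinberg
    (hSt : ∀ (q : ℕ) [Fact q.Prime], 5 ≤ q → q % 3 = 1 → ∀ 𝓛 : CartanTorusLattice q, HasSteinbergHyperplane 𝓛) :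
    P_psNonsplitNormLower := by
  intro q _ hq5 h1 𝓛 wS wC hS hSgen hC hCgen g m hm
  obtain ⟨XM, hline, -, -, -, -⟩ := line_of_steinberg 𝓛 h1 (hSt q hq5 h1 𝓛)
  exact psNonsplitNormLower_of_line 𝓛 h1 hline (exists_unipotent_sum_eq_zero 𝓛 h1 hS hSgen) hCgen g m hm

/-- **(P2) from the Steinberg hyperplanes.** -/
theorem psSplitNormSharp_of_steinberg
    (hSt : ∀ (q : ℕ) [Fact q.Prime], 5 ≤ q → q % 3 = 1 → ∀ 𝓛 : CartanTorusLattice q, HasSteinbergHyperplane 𝓛) :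
    P_psSplitNormSharp := by
  intro q _ hq5 h1 𝓛 wS wC hS hSgen hC hCgen
  obtain ⟨XM, hline, hsimple, -, hND, -⟩ := line_of_steinberg 𝓛 h1 (hSt q hq5 h1 𝓛)
  exact psSplitNormSharp_of_line 𝓛 h1 hline hsimple hND hSgen hC hCgen

/-- **(P3) from the Steinberg hyperplanes.** -/
theorem psNonsplitNormSharp_of_steinberg
    (hSt : ∀ (q : ℕ) [Fact q.Prime], 5 ≤ q → q % 3 = 1 → ∀ 𝓛 : CartanTorusLattice q, HasSteinbergHyperplane 𝓛) :
    P_psNonsplitNormSharp := by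
  intro q _ hq5 h1 𝓛 wS wC hS hSgen hC hCgen
  obtain ⟨XM, hline, hsimple, hcyc, -, hcube⟩ := line_of_steinberg 𝓛 h1 (hSt q hq5 h1 𝓛)
  exact psNonsplitNormSharp_of_line 𝓛 h1 hline hsimple hcyc hS hSgen hC hCgen
    (exists_unipotent_sum_eq_zero 𝓛 h1 hS hSgen) hcube

/-- **(F2a) `CubicTorusPeriodRatioAtThreeGeFive` (S-K1′ for all primes `q ≥ 5`) from the Steinberg hyperplanes**, via bsd-idea-10's cut
`cubicTorusPeriodRatioAtThreeGeFive_of` with the cusp inputs (C1) `cuspCubeNormFixed`, (C2) `cuspGoodConjugate` (tam3-p1 g21, theorems)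
and the principal-series inputs (P1)–(P3) above. -/
theorem cubicTorusPeriodRatioAtThreeGeFive_of_steinberg
    (hSt : ∀ (q : ℕ) [Fact q.Prime], 5 ≤ q → q % 3 = 1 → ∀ 𝓛 : CartanTorusLattice q, HasSteinbergHyperplane 𝓛) :
    CubicTorusPeriodRatioAtThreeGeFive :=
  cubicTorusPeriodRatioAtThreeGeFive_of cuspCubeNormFixed cuspGoodConjugate (psNonsplitNormLower_of_steinberg hSt)
    (psSplitNormSharp_of_steinberg hSt) (psNonsplitNormSharp_of_steinberg hSt)

end Closers

end Summit.BirchSwinnertonDyer.BirchSwinnertonDyer.Theorems.CartanTorusCubeCut.PS
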